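import Summits.BirchSwinnertonDyer.BirchSwinnertonDyer.Theorems.CountingDoorF2AtThreeRootNumberBiasMoebius
import HarnessLib

/-!
# BirchSwinnertonDyer / CountingDoorF2AtThree — crux I2 `RootNumberPlusLowerDensityLargeF2`
# (stmt-BirchSwinnertonDyer-19441), lane «closed-form local root numbers»: the residue of the T-r2 leaf as
# ONE explicit inequality about ONE explicit four-variable sum — no family quantifier, no congruence-family
# object, no root number, no Selmer group

Companion of `…RootNumberBias.lean` / `…RootNumberBiasMoebius.lean` (same lane). There the door's analytic
hypothesis was quantified over ALL large squarefree-member congruence subfamilies of `F₂` (I2sf), because the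
cell's refined door family `Φ***` is packaged existentially (`Theorems.exists_refinedDoorFamily`). Here the
family is ELIMINATED: its membership is CHARACTERISED by plain congruences — `a ≡ a* = (−524, 450, −374, 3825)
(mod 20475 = 9·25·7·13)` componentwise and `Δ(a)` squarefree (`exists_refinedDoorFamily_mem_iff`, re-running
eng-2's construction with the characterisation exported) — so its height balls are the explicit finite sets
`S(X) = {a ∈ F₂ : H(a) < X, a ≡ a* (20475), Δ(a) squarefree}` and the door hypothesis becomes a statement
about the single sequence of sums `Σ_{a ∈ S(X)} μ(m_a)·J(−c₆(a) | m_a)` (`m_a` the odd part of `|Δ(a)|`):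

* `pAdicBSDRankTwoPositiveProportion_of_selmerAverage_of_explicitClassBias` — **leaf ⟸ PublishedInputsAtThree
  + I1 + Modularity + «∃ θ < 2/3, ∀ ε > 0, eventually (Σ_{a ∈ S(X)} μ(m_a)J(−c₆(a)|m_a)) / #S(X) ≤ θ + ε»**;
* `pAdicBSDRankTwoPositiveProportion_of_selmerAverage_of_explicitClassChowla` — in particular from the
  Chowla-type statement «(Σ_{a ∈ S(X)} μ(m_a)J(−c₆(a)|m_a)) / #S(X) → 0»;
* `explicitClassBias_of_rootNumberPlusLowerDensityLargeF2` — the converse OBSTRUCTION: crux I2 as typed implies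
  that explicit inequality (modulo Modularity).

So, modulo published theorems (the inputs at `3`, Modularity) and crux I1, the route's leaf is EQUIVALENT-IN-USE
to a `2/3`-bias bound for one explicit `±1/0`-valued arithmetic function of four integers summed over one
explicit congruence class ordered by Bhargava–Ho height. HONEST STATUS: that bound is OPEN (weak Chowla for the
irreducible weighted-degree-12 form `Δ_{F₂}` twisted by a Jacobi symbol; ideation census 561570aeecec); nothing
here proves I2 or the leaf; no S0 motion. PARTITION: none — r_an ≥ 2, summit axis S0; TWIN (D-0056): n/a.
B1 honesty: bookkeeping; nothing reads r_an.

References: M. Bhargava, W. Ho, arXiv:2207.03309 §1 [BhargavaHo2022]; H. A. Helfgott, arXiv:math/0408141 §1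
[Helfgott2004RootNumber]; D. Rohrlich, *Compositio Math.* 87 (1993) Prop. 2 [Rohrlich1993Compositio];
M. Bhargava, A. Shankar, *Ann. of Math.* 181 (2015) §1 [BhargavaShankarTernary2015].
-/

set_option linter.dupNamespace false
set_option autoImplicit false

noncomputable section

open scoped Classical NumberTheorySymbols

open Filter Topology Finset WeierstrassCurve
  Literature.NumberTheory.EllipticCurves
  Literature.NumberTheory.EllipticCurves.BhargavaHo2022
  Summit.BirchSwinnertonDyer.Rank2
  Summit.BirchSwinnertonDyer.BirchSwinnertonDyer.Theses.CountingDoorF2AtThree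
  Summit.BirchSwinnertonDyer.BirchSwinnertonDyer.Theorems.SemistableRootNumber
  Summit.BirchSwinnertonDyer.BirchSwinnertonDyer.Theorems.F2RootNumber

namespace Summit.BirchSwinnertonDyer.BirchSwinnertonDyer.Theorems.F2RootNumber

/-! ### §1 Arithmetic of the class `a ≡ a* (mod 20475)` -/

/-- `x ≡ c (mod n)` as an equality in `ZMod n` is `n ∣ x − c`. [folklore] -/
private theorem intCast_zmod_eq_iff (x c : ℤ) (n : ℕ) :
    (x : ZMod n) = (c : ZMod n) ↔ (n : ℤ) ∣ x - c :=
  (ZMod.intCast_eq_intCast_iff_dvd_sub x c n).trans dvd_sub_comm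

/-- `20475 = 9 · 25 · 7 · 13` with pairwise coprime factors: divisibility by `20475` is divisibility by
`9`, `25`, `7` and `13`. [folklore] -/
private theorem dvd_20475_iff (y : ℤ) :
    (20475 : ℤ) ∣ y ↔ (9 : ℤ) ∣ y ∧ (25 : ℤ) ∣ y ∧ (7 : ℤ) ∣ y ∧ (13 : ℤ) ∣ y := by
  constructor
  · intro h
    exact ⟨dvd_trans ⟨2275, by norm_num⟩ h, dvd_trans ⟨819, by norm_num⟩ h,
      dvd_trans ⟨2925, by norm_num⟩ h, dvd_trans ⟨1575, by norm_num⟩ h⟩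
  · rintro ⟨h9, h25, h7, h13⟩
    have h91 : (91 : ℤ) ∣ y :=
      IsCoprime.mul_dvd (show IsCoprime (7 : ℤ) 13 from Int.isCoprime_iff_gcd_eq_one.mpr (by norm_num))
        h7 h13
    have h2275 : (2275 : ℤ) ∣ y :=
      IsCoprime.mul_dvd (show IsCoprime (25 : ℤ) 91 from Int.isCoprime_iff_gcd_eq_one.mpr (by norm_num))
        h25 h91
    exact IsCoprime.mul_dvd
      (show IsCoprime (9 : ℤ) 2275 from Int.isCoprime_iff_gcd_eq_one.mpr (by norm_num)) h9 h2275

/-! ### §2 The refined door family with its membership characterised by plain congruences -/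

/-- **The refined door family `Φ***`, membership characterised.** There is a large congruence subfamily `Φ`
of `F₂` with a nonempty local condition at every prime and the member `a* = (−524, 450, −374, 3825)` such that
(i) `a ∈ Φ` **iff** `a ≡ a* (mod 20475)` componentwise (`20475 = 9·25·7·13`) and `Δ(a)` is squarefree, and
(ii) every member has the local door conditions of `Theorems.leaf_of_local` (irreducible `ρ̄₃`; every globally
minimal model good ordinary at `3` with an auxiliary multiplicative prime), `ℓ² ∤ Δ(a)` at every prime, trivial
torsion and rank `≥ 2`, and Schneider non-degeneracy at `3` on every globally minimal good-ordinary rank-two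
model. This is eng-2's `Theorems.exists_refinedDoorFamily` (same construction, `exists_sieveClassFamily₁₃` at
`a*` inside the sieve-class family `Φ**`) with the characterisation (i) exported.
[cite: BhargavaHo2022, §1 (large subfamilies defined by congruence conditions)]
[cite: MazurSteinTate2006, §1 eq. (1.1) and Thm. 1.3] [cite: SilvermanAEC2009, Prop. VII.3.1(b) and Thm. VIII.6.7] -/
theorem exists_refinedDoorFamily_mem_iff :
    ∃ Φ : CongruenceFamily₂, Φ.IsLarge ∧ (∀ p : ℕ, p.Prime → (Φ.residues p).Nonempty) ∧
      Φ.Mem ⟨-524, 450, -374, 3825⟩ ∧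
      (∀ a : Params, Φ.Mem a ↔
        ((20475 : ℤ) ∣ a.a₁ + 524 ∧ (20475 : ℤ) ∣ a.a₂ - 450 ∧ (20475 : ℤ) ∣ a.a₂' + 374 ∧
          (20475 : ℤ) ∣ a.a₃ - 3825) ∧ Squarefree a.curveInt.Δ) ∧
      (∀ a : Params, Φ.Mem a →
        (a.curve.HasIrreducibleModPGaloisRep 3 ∧
          ∀ (C : VariableChange ℚ) (hC : (C • a.curve).IsGloballyMinimal),
            @IsOrdinaryAt (C • a.curve) hC 3 _ ∧ ∃ ℓ : ℕ, ∃ _ : Fact ℓ.Prime, ℓ ≠ 3 ∧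
              (C • a.curve).HasMultiplicativeReductionAtPrime ℓ ∧
              ¬ 3 ∣ padicValInt ℓ (@minimalDiscriminantInt (C • a.curve) hC)) ∧
        (∀ ℓ : ℕ, ℓ.Prime → ¬ ((ℓ : ℤ) ^ 2 ∣ a.curveInt.Δ)) ∧
        (a.curve.torsionOrder = 1 ∧ 2 ≤ a.curve.mordellWeilRank) ∧
        (∀ (C : VariableChange ℚ) (hC : (C • a.curve).IsGloballyMinimal),
          @IsOrdinaryAt (C • a.curve) hC 3 _ → (C • a.curve).mordellWeilRank = 2 →
            ∀ Dh : PAdicHeightData (C • a.curve) 3, Dh.IsCanonical → SchneiderConjecture Dh)) := by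
  -- adapted from eng-2's proof of `Theorems.exists_refinedDoorFamily` (same construction), keeping `key`
  obtain ⟨Φ, hL, hne, hmem, key⟩ := exists_sieveClassFamily₁₃ ⟨-524, 450, -374, 3825⟩
    (fun h0 ↦ not_squarefree_zero (h0 ▸ squarefree_Δ_repStar))
    (not_sq_dvd_of_squarefree squarefree_Δ_repStar)
  obtain ⟨Ψ, -, -, -, keyΨ, hlocΨ⟩ := exists_sieveClassFamily_star
  -- the representative's residues, as numerals
  have h9₁ : (((⟨-524, 450, -374, 3825⟩ : Params).a₁ : ℤ) : ZMod (3 ^ 2)) = 7 := by decide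
  have h9₂ : (((⟨-524, 450, -374, 3825⟩ : Params).a₂ : ℤ) : ZMod (3 ^ 2)) = 0 := by decide
  have h9₂' : (((⟨-524, 450, -374, 3825⟩ : Params).a₂' : ℤ) : ZMod (3 ^ 2)) = 4 := by decide
  have h9₃ : (((⟨-524, 450, -374, 3825⟩ : Params).a₃ : ℤ) : ZMod (3 ^ 2)) = 0 := by decide
  have h25₁ : (((⟨-524, 450, -374, 3825⟩ : Params).a₁ : ℤ) : ZMod (5 ^ 2)) = 1 := by decide
  have h25₂ : (((⟨-524, 450, -374, 3825⟩ : Params).a₂ : ℤ) : ZMod (5 ^ 2)) = 0 := by decide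
  have h25₂' : (((⟨-524, 450, -374, 3825⟩ : Params).a₂' : ℤ) : ZMod (5 ^ 2)) = 1 := by decide
  have h25₃ : (((⟨-524, 450, -374, 3825⟩ : Params).a₃ : ℤ) : ZMod (5 ^ 2)) = 0 := by decide
  have h7₁ : (((⟨-524, 450, -374, 3825⟩ : Params).a₁ : ℤ) : ZMod 7) = 1 := by decide
  have h7₂ : (((⟨-524, 450, -374, 3825⟩ : Params).a₂ : ℤ) : ZMod 7) = 2 := by decide
  have h7₂' : (((⟨-524, 450, -374, 3825⟩ : Params).a₂' : ℤ) : ZMod 7) = 4 := by decide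
  have h7₃ : (((⟨-524, 450, -374, 3825⟩ : Params).a₃ : ℤ) : ZMod 7) = 3 := by decide
  have h13₁ : (((⟨-524, 450, -374, 3825⟩ : Params).a₁ : ℤ) : ZMod 13) = 9 := by decide
  have h13₂ : (((⟨-524, 450, -374, 3825⟩ : Params).a₂ : ℤ) : ZMod 13) = 8 := by decide
  have h13₂' : (((⟨-524, 450, -374, 3825⟩ : Params).a₂' : ℤ) : ZMod 13) = 3 := by decide
  have h13₃ : (((⟨-524, 450, -374, 3825⟩ : Params).a₃ : ℤ) : ZMod 13) = 3 := by decide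
  -- (ii) the member-wise properties, exactly as in `exists_refinedDoorFamily`
  have hall : ∀ a : Params, Φ.Mem a →
      (a.curve.HasIrreducibleModPGaloisRep 3 ∧
        ∀ (C : VariableChange ℚ) (hC : (C • a.curve).IsGloballyMinimal),
          @IsOrdinaryAt (C • a.curve) hC 3 _ ∧ ∃ ℓ : ℕ, ∃ _ : Fact ℓ.Prime, ℓ ≠ 3 ∧
            (C • a.curve).HasMultiplicativeReductionAtPrime ℓ ∧
            ¬ 3 ∣ padicValInt ℓ (@minimalDiscriminantInt (C • a.curve) hC)) ∧
      (∀ ℓ : ℕ, ℓ.Prime → ¬ ((ℓ : ℤ) ^ 2 ∣ a.curveInt.Δ)) ∧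
      (a.curve.torsionOrder = 1 ∧ 2 ≤ a.curve.mordellWeilRank) ∧
      (∀ (C : VariableChange ℚ) (hC : (C • a.curve).IsGloballyMinimal),
        @IsOrdinaryAt (C • a.curve) hC 3 _ → (C • a.curve).mordellWeilRank = 2 →
          ∀ Dh : PAdicHeightData (C • a.curve) 3, Dh.IsCanonical → SchneiderConjecture Dh) := by
    intro a ha
    obtain ⟨haM, h9, h25, h7, ⟨t₁, t₂, t₂', t₃⟩, hsieve⟩ := (key a).mp ha
    rw [h13₁] at t₁; rw [h13₂] at t₂; rw [h13₂'] at t₂'; rw [h13₃] at t₃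
    have h13Δ : ¬ ((13 : ℤ) ∣ a.curveInt.Δ) := params_not_thirteen_dvd_Δ_of_class a t₁ t₂ t₂' t₃
    have haΨ : Ψ.Mem a := by
      refine (keyΨ a).mpr ⟨haM, ?_, ?_, ?_, fun ℓ hℓ h3 h5 h7' ↦ ?_⟩
      · rw [h9₁, h9₂, h9₂', h9₃] at h9; exact h9
      · rw [h25₁, h25₂, h25₂', h25₃] at h25; exact h25
      · rw [h7₁, h7₂, h7₂', h7₃] at h7; exact h7
      · by_cases h13 : ℓ = 13
        · subst h13
          exact fun h ↦ h13Δ (dvd_trans (dvd_pow_self _ two_ne_zero) (by exact_mod_cast h))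
        · exact hsieve ℓ hℓ h3 h5 h7' h13
    obtain ⟨hloc, hsq, ⟨c₁, c₂, c₂', c₃⟩⟩ := hlocΨ a haΨ
    rw [h9₁, h9₂, h9₂', h9₃] at h9
    rw [h7₁, h7₂, h7₂', h7₃] at h7
    obtain ⟨n₁, n₂, n₂', n₃⟩ := h9
    obtain ⟨s₁, s₂, s₂', s₃⟩ := h7
    refine ⟨hloc, hsq, params_torsionOrder_eq_one_and_two_le_rank_of_classes a haM c₁ c₂ c₂' c₃
      s₁ s₂ s₂' s₃ t₁ t₂ t₂' t₃, ?_⟩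
    haveI : a.curve.IsElliptic := Params.isElliptic_curve haM
    refine CountingDoorF2AtThreeSchneiderOnDoorSubfamilyStubTransport.stub_transport a haM hsq ?_
    intro Dh hDh hrank
    obtain ⟨dA, dB, h2, hA, hB, hC⟩ := params_heightDigits_of_class a haM hsq
      (by exact_mod_cast n₁) (by exact_mod_cast n₂) (by exact_mod_cast n₂') (by exact_mod_cast n₃)
      (params_ψ_two_markedPoint₁_zmod_seven a s₁ s₂ s₃).2 Dh hDh
    exact schneiderConjecture_of_nonresidue_digits Dh _ _ 2 3 hA hB hC h2 hrank
  refine ⟨Φ, hL, hne, hmem, fun a ↦ ?_, hall⟩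
  -- (i) the characterisation: the four classes at 9, 25, 7, 13 are one class modulo 20475
  have cast9 : ((3 ^ 2 : ℕ) : ℤ) = 9 := by norm_num
  have cast25 : ((5 ^ 2 : ℕ) : ℤ) = 25 := by norm_num
  constructor
  · intro ha
    obtain ⟨-, ⟨e₁, e₂, e₂', e₃⟩, ⟨f₁, f₂, f₂', f₃⟩, ⟨g₁, g₂, g₂', g₃⟩, ⟨t₁, t₂, t₂', t₃⟩, -⟩ :=
      (key a).mp ha
    have sf : Squarefree a.curveInt.Δ := squarefree_of_forall_not_sq_dvd (hall a ha).2.1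
    refine ⟨⟨?_, ?_, ?_, ?_⟩, sf⟩
    · rw [dvd_20475_iff, ← sub_neg_eq_add]
      exact ⟨cast9 ▸ (intCast_zmod_eq_iff _ _ _).mp e₁, cast25 ▸ (intCast_zmod_eq_iff _ _ _).mp f₁,
        (intCast_zmod_eq_iff _ _ _).mp g₁, (intCast_zmod_eq_iff _ _ _).mp t₁⟩
    · rw [dvd_20475_iff]
      exact ⟨cast9 ▸ (intCast_zmod_eq_iff _ _ _).mp e₂, cast25 ▸ (intCast_zmod_eq_iff _ _ _).mp f₂,
        (intCast_zmod_eq_iff _ _ _).mp g₂, (intCast_zmod_eq_iff _ _ _).mp t₂⟩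
    · rw [dvd_20475_iff, ← sub_neg_eq_add]
      exact ⟨cast9 ▸ (intCast_zmod_eq_iff _ _ _).mp e₂', cast25 ▸ (intCast_zmod_eq_iff _ _ _).mp f₂',
        (intCast_zmod_eq_iff _ _ _).mp g₂', (intCast_zmod_eq_iff _ _ _).mp t₂'⟩
    · rw [dvd_20475_iff]
      exact ⟨cast9 ▸ (intCast_zmod_eq_iff _ _ _).mp e₃, cast25 ▸ (intCast_zmod_eq_iff _ _ _).mp f₃,
        (intCast_zmod_eq_iff _ _ _).mp g₃, (intCast_zmod_eq_iff _ _ _).mp t₃⟩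
  · rintro ⟨⟨d₁, d₂, d₂', d₃⟩, sf⟩
    rw [dvd_20475_iff] at d₁ d₂ d₂' d₃
    rw [← sub_neg_eq_add] at d₁ d₂'
    refine (key a).mpr ⟨sf.ne_zero, ⟨?_, ?_, ?_, ?_⟩, ⟨?_, ?_, ?_, ?_⟩, ⟨?_, ?_, ?_, ?_⟩, ⟨?_, ?_, ?_, ?_⟩,
      fun ℓ hℓ _ _ _ _ ↦ not_sq_dvd_of_squarefree sf ℓ hℓ⟩
    · exact (intCast_zmod_eq_iff _ _ _).mpr (cast9 ▸ d₁.1)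
    · exact (intCast_zmod_eq_iff _ _ _).mpr (cast9 ▸ d₂.1)
    · exact (intCast_zmod_eq_iff _ _ _).mpr (cast9 ▸ d₂'.1)
    · exact (intCast_zmod_eq_iff _ _ _).mpr (cast9 ▸ d₃.1)
    · exact (intCast_zmod_eq_iff _ _ _).mpr (cast25 ▸ d₁.2.1)
    · exact (intCast_zmod_eq_iff _ _ _).mpr (cast25 ▸ d₂.2.1)
    · exact (intCast_zmod_eq_iff _ _ _).mpr (cast25 ▸ d₂'.2.1)
    · exact (intCast_zmod_eq_iff _ _ _).mpr (cast25 ▸ d₃.2.1)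
    · exact (intCast_zmod_eq_iff _ _ _).mpr d₁.2.2.1
    · exact (intCast_zmod_eq_iff _ _ _).mpr d₂.2.2.1
    · exact (intCast_zmod_eq_iff _ _ _).mpr d₂'.2.2.1
    · exact (intCast_zmod_eq_iff _ _ _).mpr d₃.2.2.1
    · exact (intCast_zmod_eq_iff _ _ _).mpr d₁.2.2.2
    · exact (intCast_zmod_eq_iff _ _ _).mpr d₂.2.2.2
    · exact (intCast_zmod_eq_iff _ _ _).mpr d₂'.2.2.2
    · exact (intCast_zmod_eq_iff _ _ _).mpr d₃.2.2.2


/-! ### §3 The height balls of the door family are explicit finite sets -/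

/-- The height balls of the refined door family are the explicit finite sets
`S(X) = {a ∈ F₂ : H(a) < X, a ≡ a* (mod 20475), Δ(a) squarefree}`. [cite: BhargavaHo2022, §1 (height on F₂)] -/
theorem below_eq_filter_of_mem_iff (Φ : CongruenceFamily₂)
    (hiff : ∀ a : Params, Φ.Mem a ↔
        ((20475 : ℤ) ∣ a.a₁ + 524 ∧ (20475 : ℤ) ∣ a.a₂ - 450 ∧ (20475 : ℤ) ∣ a.a₂' + 374 ∧
          (20475 : ℤ) ∣ a.a₃ - 3825) ∧ Squarefree a.curveInt.Δ) (X : ℕ) :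
    Φ.below X = ((BhargavaHo2022.below X).filter (fun a ↦
          ((20475 : ℤ) ∣ a.a₁ + 524 ∧ (20475 : ℤ) ∣ a.a₂ - 450 ∧ (20475 : ℤ) ∣ a.a₂' + 374 ∧
            (20475 : ℤ) ∣ a.a₃ - 3825) ∧ Squarefree a.curveInt.Δ)) := by
  ext a
  rw [CongruenceFamily₂.mem_below_iff, Finset.mem_filter, BhargavaHo2022.mem_below_iff, hiff]
  constructor
  · rintro ⟨⟨hc, hsf⟩, hH⟩
    exact ⟨⟨hsf.ne_zero, hH⟩, hc, hsf⟩
  · rintro ⟨⟨-, hH⟩, hc, hsf⟩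
    exact ⟨⟨hc, hsf⟩, hH⟩

/-! ### §4 The leaf from ONE explicit inequality; the converse obstruction -/

/-- **The T-r2 leaf from the published inputs at `3`, crux I1, the Modularity Theorem and ONE explicit
inequality.** Let `S(X)` be the finite set of `a = (a₁, a₂, a₂', a₃) ∈ ℤ⁴` with `Δ(a) ≠ 0`, Bhargava–Ho height
`H(a) < X`, `a ≡ (−524, 450, −374, 3825) (mod 20475)` componentwise and `Δ(a)` squarefree, and let
`s(a) = μ(m_a)·J(−c₆(a) | m_a)` with `m_a` the odd part of `|Δ(a)|` (`c₆`, `Δ` the explicit polynomials of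
`F₂`, `Theorems.F2RootNumber.curveInt_c₆` / `curveInt_Δ`). If for some `θ < 2/3` and every `ε > 0`,
eventually `(Σ_{a ∈ S(X)} s(a)) / #S(X) ≤ θ + ε`, then (with `PublishedInputsAtThree`, `SelmerThreeAverageLargeF2`
and Modularity) `PAdicBSDRankTwoPositiveProportion`. Proof: `S(X)` are the height balls of the refined door
family (`exists_refinedDoorFamily_mem_iff`, `below_eq_filter_of_mem_iff`), on which `s(a) = −w(E_a)`
(`liouvilleJacobiSign_eq_moebius_mul_jacobiSym`); the typed door gives `ρ > 1/6` and `Theorems.leaf_of_local`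
runs with `A = 36`. No family quantifier, no root number, no Selmer group in the analytic hypothesis.
[cite: BhargavaShankarTernary2015, §1 (first-moment method with parity)] [cite: Helfgott2004RootNumber, §1]
[cite: Rohrlich1993Compositio, Prop. 2(ii)] -/
theorem pAdicBSDRankTwoPositiveProportion_of_selmerAverage_of_explicitClassBias
    (hIn : PublishedInputsAtThree) (h1 : SelmerThreeAverageLargeF2)
    (hmod : Literature.NumberTheory.EllipticCurves.ModularForms.exists_isNewformOf)
    (hbias : ∃ θ : ℝ, θ < 2 / 3 ∧ ∀ ε : ℝ, 0 < ε → ∀ᶠ X : ℕ in atTop,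
      (∑ a ∈ ((BhargavaHo2022.below X).filter (fun a ↦
          ((20475 : ℤ) ∣ a.a₁ + 524 ∧ (20475 : ℤ) ∣ a.a₂ - 450 ∧ (20475 : ℤ) ∣ a.a₂' + 374 ∧
            (20475 : ℤ) ∣ a.a₃ - 3825) ∧ Squarefree a.curveInt.Δ)),
        ((ArithmeticFunction.moebius
            (if (2 : ℤ) ∣ a.curveInt.Δ then a.curveInt.Δ.natAbs / 2 else a.curveInt.Δ.natAbs) *
          J(-a.curveInt.c₆ | (if (2 : ℤ) ∣ a.curveInt.Δ then a.curveInt.Δ.natAbs / 2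
            else a.curveInt.Δ.natAbs)) : ℤ) : ℝ)) /
      (((BhargavaHo2022.below X).filter (fun a ↦
          ((20475 : ℤ) ∣ a.a₁ + 524 ∧ (20475 : ℤ) ∣ a.a₂ - 450 ∧ (20475 : ℤ) ∣ a.a₂' + 374 ∧
            (20475 : ℤ) ∣ a.a₃ - 3825) ∧ Squarefree a.curveInt.Δ)).card : ℝ) ≤ θ + ε) :
    PAdicBSDRankTwoPositiveProportion := by
  obtain ⟨Φ, hL, hne, hmem, hiff, hall⟩ := exists_refinedDoorFamily_mem_iff
  have hsf : ∀ a : Params, Φ.Mem a → Squarefree a.curveInt.Δ := fun a ha ↦ ((hiff a).mp ha).2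
  have hΦ : ∀ a : Params, Φ.Mem a →
      ∀ p : ℕ, p.Prime → (p : ℤ) ∣ a.curveInt.Δ → ¬ (p : ℤ) ∣ a.curveInt.c₄ := fun a ha ↦
    forall_not_dvd_c₄_of_squarefree (hsf a ha)
  have hpos : ∀ᶠ X : ℕ in atTop, 0 < (Φ.below X).card := by
    refine Filter.eventually_atTop.mpr ⟨((⟨-524, 450, -374, 3825⟩ : Params).height).toNat + 1,
      fun X hX ↦ Finset.card_pos.mpr ⟨_, (Φ.mem_below_iff _ X).mpr ⟨hmem, ?_⟩⟩⟩
    have h0 := Params.height_nonneg (⟨-524, 450, -374, 3825⟩ : Params)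
    omega
  obtain ⟨θ, hθ, hB⟩ := hbias
  -- the explicit inequality IS `Φ.AverageOnLE σ θ` for the Liouville–Jacobi sign `σ` of the typed door
  have hA : Φ.AverageOnLE (fun a ↦ ((∏ p ∈ a.curveInt.Δ.natAbs.primeFactors,
      (if p = 2 then (if (2 : ℤ) ∣ a.a₁ * a.a₃ then -1 else 1)
       else -J(-(a.curveInt.c₄ * a.curveInt.c₆) | p)) : ℤ) : ℝ)) θ := by
    intro ε hε
    filter_upwards [hB ε hε] with X hX
    refine le_of_eq_of_le ?_ hX
    unfold CongruenceFamily₂.averageOn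
    rw [below_eq_filter_of_mem_iff Φ hiff X]
    congr 1
    refine Finset.sum_congr rfl fun a ha ↦ ?_
    exact liouvilleJacobiSign_eq_moebius_mul_jacobiSym a (Finset.mem_filter.mp ha).2.2 hmod
  obtain ⟨ρ, hρ, hW⟩ := exists_gt_one_sixth_of_liouvilleJacobi_bias Φ hθ hΦ hmod hpos hA
  have hGen : Φ.HasDensityOn (fun a ↦ 2 ≤ a.curve.mordellWeilRank) 1 :=
    CountingDoorF2AtThreeSchneiderOnDoorSubfamilyStubHasDensityOnOneOfForall.stub_hasDensityOn_one_of_forall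
      Φ _ ⟨_, hmem⟩ fun a ha ↦ (hall a ha).2.2.1.2
  have hSchD :=
    CountingDoorF2AtThreeSchneiderOnDoorSubfamilyStubHasDensityOnOneOfForall.stub_hasDensityOn_one_of_forall
      Φ _ ⟨_, hmem⟩ fun a ha ↦ (hall a ha).2.2.2
  exact leaf_of_local Φ hL (fun a ha ↦ (hall a ha).1) hIn hGen (h1 Φ hL) hW (by linarith) (by linarith)
    hSchD

/-- **The leaf from a Chowla-type statement for one explicit sum.** With `S(X)` and `s(a)` as in
`pAdicBSDRankTwoPositiveProportion_of_selmerAverage_of_explicitClassBias`: if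
`(Σ_{a ∈ S(X)} μ(m_a)·J(−c₆(a) | m_a)) / #S(X) → 0` (equidistribution of the root number on the door class
— the Chowla-type expectation for the Möbius function of the discriminant form of `F₂` twisted by Rohrlich's
Jacobi symbol), then `PAdicBSDRankTwoPositiveProportion` follows from the published inputs at `3`, crux I1 and
Modularity (the door needs only the bias bound `θ < 2/3`; cancellation gives `θ = 0`).
[cite: Helfgott2004RootNumber, §1] [cite: BhargavaShankarTernary2015, §1] -/
theorem pAdicBSDRankTwoPositiveProportion_of_selmerAverage_of_explicitClassChowla
    (hIn : PublishedInputsAtThree) (h1 : SelmerThreeAverageLargeF2)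
    (hmod : Literature.NumberTheory.EllipticCurves.ModularForms.exists_isNewformOf)
    (hchowla : Tendsto (fun X : ℕ ↦
      (∑ a ∈ ((BhargavaHo2022.below X).filter (fun a ↦
          ((20475 : ℤ) ∣ a.a₁ + 524 ∧ (20475 : ℤ) ∣ a.a₂ - 450 ∧ (20475 : ℤ) ∣ a.a₂' + 374 ∧
            (20475 : ℤ) ∣ a.a₃ - 3825) ∧ Squarefree a.curveInt.Δ)),
        ((ArithmeticFunction.moebius
            (if (2 : ℤ) ∣ a.curveInt.Δ then a.curveInt.Δ.natAbs / 2 else a.curveInt.Δ.natAbs) *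
          J(-a.curveInt.c₆ | (if (2 : ℤ) ∣ a.curveInt.Δ then a.curveInt.Δ.natAbs / 2
            else a.curveInt.Δ.natAbs)) : ℤ) : ℝ)) /
      (((BhargavaHo2022.below X).filter (fun a ↦
          ((20475 : ℤ) ∣ a.a₁ + 524 ∧ (20475 : ℤ) ∣ a.a₂ - 450 ∧ (20475 : ℤ) ∣ a.a₂' + 374 ∧
            (20475 : ℤ) ∣ a.a₃ - 3825) ∧ Squarefree a.curveInt.Δ)).card : ℝ)) atTop (𝓝 0)) :
    PAdicBSDRankTwoPositiveProportion :=
  pAdicBSDRankTwoPositiveProportion_of_selmerAverage_of_explicitClassBias hIn h1 hmod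
    ⟨0, by norm_num, fun ε hε ↦ (hchowla.eventually (gt_mem_nhds hε)).mono fun X hX ↦ by
      rw [zero_add]; exact le_of_lt hX⟩

/-- **The converse obstruction: crux I2 proves the explicit inequality.** If
`RootNumberPlusLowerDensityLargeF2` holds then — modulo the Modularity Theorem — for some `θ < 2/3` and every
`ε > 0`, eventually `(Σ_{a ∈ S(X)} μ(m_a)·J(−c₆(a) | m_a)) / #S(X) ≤ θ + ε`, with `S(X)`, `m_a` as in
`pAdicBSDRankTwoPositiveProportion_of_selmerAverage_of_explicitClassBias`: any proof of I2 as typed proves a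
`2/3`-bias weak-Chowla bound for this one explicit sum (I2 applied to the refined door family, whose height
balls are the `S(X)` and whose members' root numbers are `−μ(m_a)·J(−c₆(a) | m_a)`).
[cite: Helfgott2004RootNumber, §1] [cite: Rohrlich1993Compositio, Prop. 2(ii)] [cite: BhargavaHo2022, §1] -/
theorem explicitClassBias_of_rootNumberPlusLowerDensityLargeF2
    (hmod : Literature.NumberTheory.EllipticCurves.ModularForms.exists_isNewformOf)
    (h2 : RootNumberPlusLowerDensityLargeF2) :
    ∃ θ : ℝ, θ < 2 / 3 ∧ ∀ ε : ℝ, 0 < ε → ∀ᶠ X : ℕ in atTop,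
      (∑ a ∈ ((BhargavaHo2022.below X).filter (fun a ↦
          ((20475 : ℤ) ∣ a.a₁ + 524 ∧ (20475 : ℤ) ∣ a.a₂ - 450 ∧ (20475 : ℤ) ∣ a.a₂' + 374 ∧
            (20475 : ℤ) ∣ a.a₃ - 3825) ∧ Squarefree a.curveInt.Δ)),
        ((ArithmeticFunction.moebius
            (if (2 : ℤ) ∣ a.curveInt.Δ then a.curveInt.Δ.natAbs / 2 else a.curveInt.Δ.natAbs) *
          J(-a.curveInt.c₆ | (if (2 : ℤ) ∣ a.curveInt.Δ then a.curveInt.Δ.natAbs / 2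
            else a.curveInt.Δ.natAbs)) : ℤ) : ℝ)) /
      (((BhargavaHo2022.below X).filter (fun a ↦
          ((20475 : ℤ) ∣ a.a₁ + 524 ∧ (20475 : ℤ) ∣ a.a₂ - 450 ∧ (20475 : ℤ) ∣ a.a₂' + 374 ∧
            (20475 : ℤ) ∣ a.a₃ - 3825) ∧ Squarefree a.curveInt.Δ)).card : ℝ) ≤ θ + ε := by
  obtain ⟨Φ, hL, hne, -, hiff, -⟩ := exists_refinedDoorFamily_mem_iff
  have hsf : ∀ a : Params, Φ.Mem a → Squarefree a.curveInt.Δ := fun a ha ↦ ((hiff a).mp ha).2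
  obtain ⟨θ, hθ, hA⟩ := liouvilleJacobiBias_of_rootNumberPlusLowerDensityLargeF2 hmod h2 Φ hL hne hsf
  refine ⟨θ, hθ, fun ε hε ↦ ?_⟩
  filter_upwards [hA ε hε] with X hX
  refine le_of_eq_of_le ?_ hX
  unfold CongruenceFamily₂.averageOn
  rw [below_eq_filter_of_mem_iff Φ hiff X]
  congr 1
  refine Finset.sum_congr rfl fun a ha ↦ ?_
  exact (liouvilleJacobiSign_eq_moebius_mul_jacobiSym a (Finset.mem_filter.mp ha).2.2 hmod).symm

end Summit.BirchSwinnertonDyer.BirchSwinnertonDyer.Theorems.F2RootNumber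

end
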